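import Literature.Analysis.FluidPDE.TorusVorticityMomentBalance
import Literature.Analysis.FunctionSpaces.TorusSpaceTimeTaylor
import Literature.Analysis.FunctionSpaces.TorusChainRule
import HarnessLib

/-!
# The weighted vorticity balance with a `C¹` weight; exact `Z_q` derivative for real `q ≥ 2`

Analysis/FluidPDE proof file (theorems only; no definitions, no named facts). The tree's weighted
balance `d/dt ∫ Φ(|ω|²)` (`TorusWeightedVorticityBalance`) asks for a weight `Φ` that is `C^∞`
near the values of `|ω|²`, because it integrates the viscous term by parts twice. For the moments
`Z_q = ∫ (|ω|²)^{q/2}` with non-integer `q/2` the weight `s ↦ s^{q/2}` is only `C¹` at `s = 0`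
(`q ≥ 2`), which is all that the opening identity of Gibbon 2010, App. A needs:

`(1/2m) J̇ₘ = ∫ |ω|^{2(m−1)} ω·{νΔω + (ω·∇)u + curl f}`, `Jₘ = ∫|ω|^{2m}`, real `m ≥ 1`

(Gibbon 2010, §1: the moments are defined "for `m ≥ 1`"). This file proves, along a classical
solution of the forced Navier–Stokes/Euler system on `T^d × [a, b]`:

* `IsClassicalNSSolutionOn.hasDerivWithinAt_integral_comp_torusVorticitySqAt_of_contDiffOn_one` —
  for `Φ` of class `C¹` on an open set containing the values of `|ω|²`:
  `d/dt ∫ Φ(|ω|²) = 2∫Φ'(|ω|²)σ + ν∫Φ'(|ω|²)∑ᵢⱼWᵢⱼΔWᵢⱼ + ∫Φ'(|ω|²)∑ᵢⱼWᵢⱼ(∂ᵢfⱼ − ∂ⱼfᵢ)`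
  (one-sided, within `[a, b]`; the transport term `∫Φ'(|ω|²)(u·∇)|ω|² = ∫ div(Φ(|ω|²)u) = 0`
  by the `C¹` divergence theorem; the viscous term is left as printed, not integrated by parts);
* `IsClassicalNSSolutionOn.hasDerivWithinAt_integral_torusVorticitySqAt_rpow` — `Φ(s) = s^{q/2}`,
  real `q ≥ 2`: `d/dt Z_q = q∫(|ω|²)^{q/2−1}σ + (q/2)(ν∫(|ω|²)^{q/2−1}∑WΔW + ∫(|ω|²)^{q/2−1}∑W·curl f)`,
  i.e. `2m ×` Gibbon's display with `q = 2m` (`∑ᵢⱼWᵢⱼΔWᵢⱼ = 2ω·Δω`, `σ = ω·(ω·∇)u`,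
  `∑W·curl f = 2ω·curl f` in `d = 3`);
* `IsClassicalNSSolutionOn.hasDerivWithinAt_integral_torusVorticitySqAt_rpow_euler` — unforced
  Euler (`ν = 0`, `f = 0`): `d/dt Z_q = q ∫ (|ω|²)^{q/2−1} σ` exactly.

With `TorusVorticityRealMomentBalance` (the inequality `Ż_q ≤ q∫(|ω|²)^{q/2−1}σ` for `ν ≥ 0`)
this is the complete real-exponent (`q ≥ 2`) form of the `Z_q` balance. A priori identities along
smooth solutions only; nothing here is a regularity criterion.

## References

* J. D. Gibbon, *Regularity and singularity in solutions of the three-dimensional Navier–Stokes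
  equations*, Proc. R. Soc. A 466 (2010) 2587–2604, §1 and Appendix A (proof of Prop. 1, opening
  identity). [Gibbon2010]
* A. J. Majda, A. L. Bertozzi, *Vorticity and Incompressible Flow*, CUP 2002, §1.4 (1.31)–(1.32).
  [MajdaBertozziCUP2002]
* L. C. Evans, *Partial Differential Equations*, 2nd ed., AMS 2010, App. C.2 (Gauss–Green). [Evans2010]
-/

noncomputable section

open Set MeasureTheory Filter Topology
open scoped ContDiff InnerProductSpace RealInnerProductSpace

namespace Literature.Analysis.FluidPDE

open Literature.Analysis.FunctionSpaces

variable {d : Type*} [Fintype d] [DecidableEq d]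

namespace VorticityC1Weight

/-! ### Smoothness bookkeeping -/

/-- `Wᵢⱼ` of a smooth field is smooth. [folklore] -/
private theorem isSmooth_W {v : UnitAddTorus d → EuclideanSpace ℝ d}
    (hv : Torus.IsSmooth v) (i j : d) : Torus.IsSmooth (torusVorticityTensor v i j) :=
  ((hv.partialDeriv i).apply j).sub ((hv.partialDeriv j).apply i)

/-- `|ω|²` of a smooth field is smooth. [folklore] -/
private theorem isSmooth_Q {v : UnitAddTorus d → EuclideanSpace ℝ d}
    (hv : Torus.IsSmooth v) : Torus.IsSmooth (torusVorticitySqAt v) := by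
  have h : ∀ i j, Torus.IsSmooth (fun y => torusVorticityTensor v i j y ^ 2) := fun i j => by
    have := isSmooth_W hv i j
    exact this.pow 2
  have hl : Torus.lift (torusVorticitySqAt v) =
      fun z => (2⁻¹ : ℝ) * ∑ i, ∑ j, Torus.lift (fun y => torusVorticityTensor v i j y ^ 2) z := by
    funext z; rfl
  unfold Torus.IsSmooth at h ⊢
  rw [hl]
  exact contDiff_const.mul (ContDiff.sum fun i _ => ContDiff.sum fun j _ => h i j)

/-- `σ` of a smooth field is smooth. [folklore] -/
private theorem isSmooth_σ {v : UnitAddTorus d → EuclideanSpace ℝ d}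
    (hv : Torus.IsSmooth v) : Torus.IsSmooth (torusStretchingDensity v) := by
  have hD : ∀ i k, Torus.IsSmooth (fun y => Torus.partialDeriv i v y k) :=
    fun i k => (hv.partialDeriv i).apply k
  have h : ∀ i j k, Torus.IsSmooth (fun y => torusVorticityTensor v i j y *
      (Torus.partialDeriv i v y k * Torus.partialDeriv k v y j)) :=
    fun i j k => (isSmooth_W hv i j).mul ((hD i k).mul (hD k j))
  have hl : Torus.lift (torusStretchingDensity v) = fun z => -∑ i, ∑ j, ∑ k, Torus.lift
      (fun y => torusVorticityTensor v i j y *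
        (Torus.partialDeriv i v y k * Torus.partialDeriv k v y j)) z := by
    funext z
    simp only [Torus.lift_apply, torusStretchingDensity, Finset.mul_sum]
  unfold Torus.IsSmooth at h ⊢
  rw [hl]
  exact (ContDiff.sum fun i _ => ContDiff.sum fun j _ => ContDiff.sum fun k _ => h i j k).neg

omit [DecidableEq d] in
/-- Double finite sums of smooth scalar functions on the torus are smooth. [folklore] -/
private theorem isSmooth_sum₂ {g : d → d → UnitAddTorus d → ℝ} (hg : ∀ i j, Torus.IsSmooth (g i j)) :
    Torus.IsSmooth (fun y => ∑ i, ∑ j, g i j y) := by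
  have hl : Torus.lift (fun y => ∑ i, ∑ j, g i j y) = fun z => ∑ i, ∑ j, Torus.lift (g i j) z := by
    funext z; simp only [Torus.lift_apply]
  unfold Torus.IsSmooth at hg ⊢
  rw [hl]
  exact ContDiff.sum fun i _ => ContDiff.sum fun j _ => hg i j

omit [DecidableEq d] in
/-- Finite sums of smooth scalar functions on the torus are smooth. [folklore] -/
private theorem isSmooth_sum₁ {g : d → UnitAddTorus d → ℝ} (hg : ∀ i, Torus.IsSmooth (g i)) :
    Torus.IsSmooth (fun y => ∑ i, g i y) := by
  have hl : Torus.lift (fun y => ∑ i, g i y) = fun z => ∑ i, Torus.lift (g i) z := by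
    funext z; simp only [Torus.lift_apply]
  unfold Torus.IsSmooth at hg ⊢
  rw [hl]
  exact ContDiff.sum fun i _ => hg i

/-- `(s, y) ↦ Wᵢⱼ(u(s))(y)` is jointly smooth on `[a, b] × T^d`. [folklore] -/
private theorem isSmoothSpaceTimeOn_W {a b : ℝ}
    {u : ℝ → UnitAddTorus d → EuclideanSpace ℝ d} (hu : Torus.IsSmoothSpaceTimeOn (Icc a b) u)
    (hab : a < b) (i j : d) :
    Torus.IsSmoothSpaceTimeOn (Icc a b) (fun s y => torusVorticityTensor (u s) i j y) :=
  ((hu.partialDeriv (uniqueDiffOn_Icc hab) i).apply j).sub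
    ((hu.partialDeriv (uniqueDiffOn_Icc hab) j).apply i)

/-- `(s, y) ↦ |ω(u(s))(y)|²` is jointly smooth on `[a, b] × T^d`. [folklore] -/
private theorem isSmoothSpaceTimeOn_Q {a b : ℝ}
    {u : ℝ → UnitAddTorus d → EuclideanSpace ℝ d} (hu : Torus.IsSmoothSpaceTimeOn (Icc a b) u)
    (hab : a < b) :
    Torus.IsSmoothSpaceTimeOn (Icc a b) (fun s y => torusVorticitySqAt (u s) y) := by
  have h : ∀ i j, Torus.IsSmoothSpaceTimeOn (Icc a b)
      (fun s y => torusVorticityTensor (u s) i j y * torusVorticityTensor (u s) i j y) :=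
    fun i j => (isSmoothSpaceTimeOn_W hu hab i j).mul (isSmoothSpaceTimeOn_W hu hab i j)
  have hs := Torus.IsSmoothSpaceTimeOn.sum (s := Finset.univ) fun i (_ : i ∈ Finset.univ) =>
    Torus.IsSmoothSpaceTimeOn.sum (s := Finset.univ) fun j (_ : j ∈ Finset.univ) => h i j
  have hfun : (fun s y => torusVorticitySqAt (u s) y) = fun s y => (2⁻¹ : ℝ) •
      ∑ i, ∑ j, torusVorticityTensor (u s) i j y * torusVorticityTensor (u s) i j y := by
    funext s y
    simp only [torusVorticitySqAt, torusVorticityTensor, smul_eq_mul]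
    congr 1
    exact Finset.sum_congr rfl fun i _ => Finset.sum_congr rfl fun j _ => by ring
  rw [hfun]
  exact hs.const_smul (2⁻¹ : ℝ)

/-! ### Calculus lemmas -/

/-- `∂ₖ|ω|² = ∑ᵢⱼ Wᵢⱼ ∂ₖWᵢⱼ` for smooth `v`. [folklore] -/
private theorem partialDeriv_Q {v : UnitAddTorus d → EuclideanSpace ℝ d}
    (hv : Torus.IsSmooth v) (k : d) (x : UnitAddTorus d) :
    Torus.partialDeriv k (torusVorticitySqAt v) x =
      ∑ i, ∑ j, torusVorticityTensor v i j x * Torus.partialDeriv k (torusVorticityTensor v i j) x := by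
  have hW1 : ∀ i j, Torus.IsContDiff 1 (torusVorticityTensor v i j) :=
    fun i j => (isSmooth_W hv i j).isContDiff (by simp)
  have hsq : ∀ i j, Torus.IsContDiff 1
      (fun y => torusVorticityTensor v i j y * torusVorticityTensor v i j y) :=
    fun i j => (hW1 i j).mul (hW1 i j)
  have hrow : ∀ i, Torus.IsContDiff 1
      (fun y => ∑ j, torusVorticityTensor v i j y * torusVorticityTensor v i j y) := by
    intro i
    have h : Torus.lift (fun y => ∑ j, torusVorticityTensor v i j y * torusVorticityTensor v i j y) =
        fun z => ∑ j, Torus.lift (fun y => torusVorticityTensor v i j y *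
          torusVorticityTensor v i j y) z := rfl
    unfold Torus.IsContDiff
    rw [h]
    exact ContDiff.sum fun j _ => hsq i j
  have hfun : torusVorticitySqAt v = fun y => (2⁻¹ : ℝ) •
      ∑ i, ∑ j, torusVorticityTensor v i j y * torusVorticityTensor v i j y := by
    funext y
    simp only [torusVorticitySqAt, torusVorticityTensor, smul_eq_mul]
    congr 1
    exact Finset.sum_congr rfl fun i _ => Finset.sum_congr rfl fun j _ => by ring
  rw [hfun, Torus.partialDeriv_smul (Torus.isContDiff_const _) ?_ k x]
  swap
  · have h : Torus.lift (fun y => ∑ i, ∑ j, torusVorticityTensor v i j y *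
        torusVorticityTensor v i j y) = fun z => ∑ i, Torus.lift (fun y => ∑ j,
          torusVorticityTensor v i j y * torusVorticityTensor v i j y) z := rfl
    unfold Torus.IsContDiff
    rw [h]
    exact ContDiff.sum fun i _ => hrow i
  have hc : Torus.partialDeriv k (fun _ : UnitAddTorus d => (2⁻¹ : ℝ)) x = 0 := by
    simp [Torus.partialDeriv, Torus.lineDeriv]
  rw [hc, zero_smul, add_zero, Torus.partialDeriv_finset_sum _ (fun i _ => hrow i), smul_eq_mul,
    Finset.mul_sum]
  refine Finset.sum_congr rfl fun i _ => ?_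
  rw [Torus.partialDeriv_finset_sum _ (fun j _ => hsq i j), Finset.mul_sum]
  refine Finset.sum_congr rfl fun j _ => ?_
  rw [Torus.partialDeriv_mul (hW1 i j) (hW1 i j)]
  ring

omit [Fintype d] in
/-- Chain rule `∂ₖ(g ∘ θ) = g'(θ) ∂ₖθ` at points where `g` is differentiable (`θ` of class
`C¹`). [folklore] -/
private theorem partialDeriv_comp_deriv [Fintype d] {g : ℝ → ℝ} {θ : UnitAddTorus d → ℝ}
    (hθ : Torus.IsContDiff 1 θ) (x : UnitAddTorus d) (hg : DifferentiableAt ℝ g (θ x)) (k : d) :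
    Torus.partialDeriv k (fun y => g (θ y)) x = deriv g (θ x) * Torus.partialDeriv k θ x := by
  unfold Torus.partialDeriv Torus.lineDeriv
  set v : EuclideanSpace ℝ d := EuclideanSpace.single k 1
  have hθ' : HasDerivAt (fun s : ℝ => θ (x + Torus.proj (s • v))) (Torus.lineDeriv θ x v) 0 := by
    simpa using Torus.hasDerivAt_comp_add_proj_smul hθ x v 0
  have hx0 : θ (x + Torus.proj ((0 : ℝ) • v)) = θ x := by simp
  have hg' : HasDerivAt g (deriv g (θ (x + Torus.proj ((0 : ℝ) • v))))
      (θ (x + Torus.proj ((0 : ℝ) • v))) := by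
    rw [hx0]; exact hg.hasDerivAt
  have hc := hg'.comp 0 hθ'
  have hfun : (fun t : ℝ => (fun y => g (θ y)) (x + Torus.proj (t • v))) =
      g ∘ fun s : ℝ => θ (x + Torus.proj (s • v)) := rfl
  rw [hfun, hc.deriv, hx0]
  unfold Torus.lineDeriv
  ring

/-- **Transport term with a `C¹` weight**: for smooth divergence-free `v` and `g` of class `C¹`
on an open set containing the values of `|ω|²`,
`∫ g'(|ω|²) ∑ₖ vₖ ∑ᵢⱼ Wᵢⱼ ∂ₖWᵢⱼ = ∫ (v·∇)(g(|ω|²)) = ∫ div(g(|ω|²) v) = 0`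
(`C¹` divergence theorem on the torus). [folklore] -/
private theorem integral_deriv_comp_mul_convect_Q_eq_zero_C1
    {v : UnitAddTorus d → EuclideanSpace ℝ d} (hv : Torus.IsSmooth v) (hdiv : Torus.IsDivFree v)
    {g : ℝ → ℝ} {U : Set ℝ} (hU : IsOpen U) (hg : ContDiffOn ℝ 1 g U)
    (hmaps : ∀ x, torusVorticitySqAt v x ∈ U) :
    ∫ x, deriv g (torusVorticitySqAt v x) * ∑ k, v x k * ∑ i, ∑ j,
      torusVorticityTensor v i j x * Torus.partialDeriv k (torusVorticityTensor v i j) x = 0 := by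
  have hQ : Torus.IsSmooth (torusVorticitySqAt v) := isSmooth_Q hv
  have hQ1 : Torus.IsContDiff 1 (torusVorticitySqAt v) := hQ.isContDiff (by simp)
  have hv1 : Torus.IsContDiff 1 v := hv.isContDiff (by simp)
  -- `θ = g ∘ |ω|²` is `C¹`
  have hθ : Torus.IsContDiff 1 (fun y => g (torusVorticitySqAt v y)) := by
    unfold Torus.IsContDiff at hQ1 ⊢
    exact hg.comp_contDiff hQ1 fun z => hmaps _
  -- `θ • v` is `C¹`
  have hθv : Torus.IsContDiff 1 (fun y => g (torusVorticitySqAt v y) • v y) := by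
    unfold Torus.IsContDiff at hθ hv1 ⊢
    exact hθ.smul hv1
  -- pointwise: the integrand is `div(θ v)`
  have hpt : ∀ x, deriv g (torusVorticitySqAt v x) * ∑ k, v x k * ∑ i, ∑ j,
      torusVorticityTensor v i j x * Torus.partialDeriv k (torusVorticityTensor v i j) x =
      Torus.divergence (fun y => g (torusVorticitySqAt v y) • v y) x := by
    intro x
    rw [Torus.divergence_smul hθ hv1 x, hdiv x, mul_zero, zero_add, Finset.mul_sum]
    refine Finset.sum_congr rfl fun k _ => ?_
    have hgd : DifferentiableAt ℝ g (torusVorticitySqAt v x) :=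
      (hg.differentiableOn (by simp)).differentiableAt (hU.mem_nhds (hmaps x))
    rw [partialDeriv_comp_deriv hQ1 x hgd k, partialDeriv_Q hv k x]
    ring
  simp_rw [hpt]
  exact Torus.integral_divergence_eq_zero_of_isContDiff hθv

omit [DecidableEq d] in
/-- Continuous functions on the (compact) torus are integrable. [folklore] -/
private theorem integrable_of_continuous {g : UnitAddTorus d → ℝ} (hg : Continuous g) :
    Integrable g := by
  have := hg.continuousOn.integrableOn_compact (μ := volume) isCompact_univ
  simpa using this

omit [DecidableEq d] in
/-- **Differentiation under `∫_{T^d}` with a `C¹` outer function.** For `θ` jointly smooth on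
`[a, b] × T^d` (`a < b`) and `Φ` of class `C¹` on an open `U ⊇ θ([a, b] × T^d)`,
`s ↦ ∫ Φ(θ(s, x)) dx` has the one-sided derivative `∫ Φ'(θ(t, x)) ∂ₜθ(t, x) dx` within `[a, b]`
at every `t ∈ [a, b]` (uniform first-order Taylor expansion of `θ` in time over the compact torus,
uniform continuity of `Φ'` on a compact neighbourhood of the values, mean value inequality). [folklore] -/
private theorem hasDerivWithinAt_integral_comp_C1 {a b : ℝ} (hab : a < b)
    {θ : ℝ → UnitAddTorus d → ℝ} (hθ : Torus.IsSmoothSpaceTimeOn (Icc a b) θ)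
    {Φ : ℝ → ℝ} {U : Set ℝ} (hUo : IsOpen U) (hΦ : ContDiffOn ℝ 1 Φ U)
    (hmaps : ∀ s ∈ Icc a b, ∀ x, θ s x ∈ U) {t : ℝ} (ht : t ∈ Icc a b) :
    HasDerivWithinAt (fun s => ∫ x, Φ (θ s x))
      (∫ x, deriv Φ (θ t x) * Torus.timeDerivWithin (Icc a b) θ t x) (Icc a b) t := by
  set S : Set ℝ := Icc a b with hSdef
  have hU : UniqueDiffOn ℝ S := uniqueDiffOn_Icc hab
  have hθc : ∀ s ∈ S, Continuous (θ s) := fun s hs => (hθ.isSmooth_slice hs).continuous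
  have hΦc : ContinuousOn Φ U := hΦ.continuousOn
  have hΦ'c : ContinuousOn (deriv Φ) U := hΦ.continuousOn_deriv_of_isOpen hUo le_rfl
  have hΦd : ∀ y ∈ U, DifferentiableAt ℝ Φ y := fun y hy =>
    (hΦ.differentiableOn (by simp)).differentiableAt (hUo.mem_nhds hy)
  set θ' : UnitAddTorus d → ℝ := Torus.timeDerivWithin S θ t with hθ'def
  have hθ'c : Continuous θ' := (hθ.isSmooth_timeDerivWithin hU ht).continuous
  -- the compact set of values at time `t`, and a compact thickening inside `U`
  set K : Set ℝ := range (θ t) with hKdef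
  have hKc : IsCompact K := isCompact_range (hθc t ht)
  have hKU : K ⊆ U := by
    rintro _ ⟨x, rfl⟩
    exact hmaps t ht x
  obtain ⟨ρ, hρ, hρU⟩ := hKc.exists_cthickening_subset_open hUo hKU
  set K₁ : Set ℝ := Metric.cthickening ρ K with hK₁def
  have hK₁c : IsCompact K₁ := hKc.cthickening
  have hKK₁ : K ⊆ K₁ := Metric.self_subset_cthickening K
  -- bounds
  obtain ⟨A, hA⟩ : ∃ A : ℝ, ∀ x, |θ' x| ≤ A := by
    obtain ⟨C, hC⟩ := isCompact_univ.exists_bound_of_continuousOn hθ'c.continuousOn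
    exact ⟨C, fun x => by simpa [Real.norm_eq_abs] using hC x (mem_univ x)⟩
  obtain ⟨B, hB⟩ : ∃ B : ℝ, ∀ y ∈ K₁, |deriv Φ y| ≤ B := by
    obtain ⟨C, hC⟩ := hK₁c.exists_bound_of_continuousOn (hΦ'c.mono hρU)
    exact ⟨C, fun y hy => by simpa [Real.norm_eq_abs] using hC y hy⟩
  have hA0 : 0 ≤ A := le_trans (abs_nonneg _) (hA 0)
  have hB0 : 0 ≤ B := le_trans (abs_nonneg _) (hB (θ t 0) (hKK₁ ⟨0, rfl⟩))
  -- uniform continuity of `Φ'` on `K₁`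
  have hUC : ∀ ε' > 0, ∃ η > 0, ∀ y ∈ K₁, ∀ y' ∈ K₁, dist y y' < η →
      dist (deriv Φ y) (deriv Φ y') < ε' := fun ε' hε' =>
    Metric.uniformContinuousOn_iff.mp
      (hK₁c.uniformContinuousOn_of_continuous (hΦ'c.mono hρU)) ε' hε'
  -- integrability
  have hintΦ : ∀ s ∈ S, Integrable (fun x => Φ (θ s x)) := fun s hs =>
    integrable_of_continuous (hΦc.comp_continuous (hθc s hs) (hmaps s hs))
  have hintD : Integrable (fun x => deriv Φ (θ t x) * θ' x) :=
    integrable_of_continuous ((hΦ'c.comp_continuous (hθc t ht) (hmaps t ht)).mul hθ'c)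
  -- the `o(|s − t|)` estimate
  rw [hasDerivWithinAt_iff_isLittleO, Asymptotics.isLittleO_iff]
  intro c hc
  set ε₁ : ℝ := c / (2 * (A + 1)) with hε₁def
  set ε₂ : ℝ := c / (2 * (B + 1)) with hε₂def
  have hε₁ : 0 < ε₁ := by positivity
  have hε₂ : 0 < ε₂ := by positivity
  obtain ⟨η, hη, hηUC⟩ := hUC ε₁ hε₁
  have ev1 := hθ.eventually_norm_sub_sub_smul_le (convex_Icc a b) ht hε₂
  have ev1' := hθ.eventually_norm_sub_sub_smul_le (convex_Icc a b) ht one_pos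
  have ev2 := hθ.eventually_norm_sub_lt ht (lt_min hρ hη)
  have ev3 : ∀ᶠ s in 𝓝[S] t, s ∈ S := self_mem_nhdsWithin
  filter_upwards [ev1, ev1', ev2, ev3] with s hs1 hs1' hs2 hsS
  -- pointwise bound
  have hpt : ∀ x, |Φ (θ s x) - Φ (θ t x) - (s - t) * (deriv Φ (θ t x) * θ' x)| ≤ c * |s - t| := by
    intro x
    have hy₀K : θ t x ∈ K := ⟨x, rfl⟩
    have hy₀K₁ : θ t x ∈ K₁ := hKK₁ hy₀K
    have hdist : dist (θ s x) (θ t x) < min ρ η := by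
      rw [Real.dist_eq]
      have := hs2 x
      rwa [Real.norm_eq_abs] at this
    have hball : ∀ z ∈ Metric.ball (θ t x) (min ρ η), z ∈ K₁ := fun z hz =>
      Metric.mem_cthickening_of_dist_le z (θ t x) ρ K hy₀K
        ((Metric.mem_ball.1 hz).le.trans (min_le_left _ _))
    have hballU : ∀ z ∈ Metric.ball (θ t x) (min ρ η), z ∈ U := fun z hz => hρU (hball z hz)
    -- first piece: `|Φ(y) − Φ(y₀) − Φ'(y₀)(y − y₀)| ≤ ε₁ |y − y₀|`
    have hg : ∀ z ∈ Metric.ball (θ t x) (min ρ η),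
        DifferentiableAt ℝ (fun z => Φ z - deriv Φ (θ t x) * z) z := fun z hz =>
      (hΦd z (hballU z hz)).sub ((differentiableAt_id).const_mul _)
    have hgb : ∀ z ∈ Metric.ball (θ t x) (min ρ η),
        ‖deriv (fun z => Φ z - deriv Φ (θ t x) * z) z‖ ≤ ε₁ := by
      intro z hz
      have hdz : deriv (fun z => Φ z - deriv Φ (θ t x) * z) z = deriv Φ z - deriv Φ (θ t x) := by
        have hd := ((hΦd z (hballU z hz)).hasDerivAt.sub
          ((hasDerivAt_id' z).const_mul (deriv Φ (θ t x)))).deriv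
        rw [show (Φ - fun y => deriv Φ (θ t x) * y) = (fun z => Φ z - deriv Φ (θ t x) * z) from rfl]
          at hd
        rw [hd]
        ring
      rw [hdz, Real.norm_eq_abs]
      have hzη : dist z (θ t x) < η := lt_of_lt_of_le (Metric.mem_ball.1 hz) (min_le_right _ _)
      have := hηUC z (hball z hz) (θ t x) hy₀K₁ hzη
      rw [Real.dist_eq] at this
      exact this.le
    have hmv := (convex_ball (θ t x) (min ρ η)).norm_image_sub_le_of_norm_deriv_le hg hgb
      (Metric.mem_ball_self (lt_min hρ hη)) (Metric.mem_ball.2 hdist)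
    rw [Real.norm_eq_abs, Real.norm_eq_abs] at hmv
    have e1 : (Φ (θ s x) - deriv Φ (θ t x) * θ s x) - (Φ (θ t x) - deriv Φ (θ t x) * θ t x) =
        Φ (θ s x) - Φ (θ t x) - deriv Φ (θ t x) * (θ s x - θ t x) := by ring
    rw [e1] at hmv
    -- `|y − y₀| ≤ (1 + A)|s − t|`
    have hlip : |θ s x - θ t x| ≤ (A + 1) * |s - t| := by
      have h1 := hs1' x
      rw [Real.norm_eq_abs, smul_eq_mul, one_mul] at h1
      have h2 : |(s - t) * θ' x| ≤ |s - t| * A := by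
        rw [abs_mul]
        exact mul_le_mul_of_nonneg_left (hA x) (abs_nonneg _)
      have h3 := abs_sub_abs_le_abs_sub (θ s x - θ t x) ((s - t) * θ' x)
      nlinarith [h1, h2, h3, abs_nonneg (s - t)]
    -- second piece: `|Φ'(y₀)| |y − y₀ − (s − t)θ'| ≤ B ε₂ |s − t|`
    have htay := hs1 x
    rw [Real.norm_eq_abs, smul_eq_mul] at htay
    have hBy : |deriv Φ (θ t x)| ≤ B := hB _ hy₀K₁
    -- assemble
    have e2 : Φ (θ s x) - Φ (θ t x) - (s - t) * (deriv Φ (θ t x) * θ' x) =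
        (Φ (θ s x) - Φ (θ t x) - deriv Φ (θ t x) * (θ s x - θ t x)) +
          deriv Φ (θ t x) * (θ s x - θ t x - (s - t) * θ' x) := by ring
    rw [e2]
    have h4 : |deriv Φ (θ t x) * (θ s x - θ t x - (s - t) * θ' x)| ≤ B * (ε₂ * |s - t|) := by
      rw [abs_mul]
      exact mul_le_mul hBy htay (abs_nonneg _) hB0
    have h5 : |Φ (θ s x) - Φ (θ t x) - deriv Φ (θ t x) * (θ s x - θ t x)| ≤
        ε₁ * ((A + 1) * |s - t|) := hmv.trans (mul_le_mul_of_nonneg_left hlip hε₁.le)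
    have h6 : ε₁ * ((A + 1) * |s - t|) + B * (ε₂ * |s - t|) ≤ c * |s - t| := by
      have hA1 : ε₁ * (A + 1) = c / 2 := by
        rw [hε₁def]; field_simp
      have hB1 : B * ε₂ ≤ c / 2 := by
        rw [hε₂def]
        rw [show B * (c / (2 * (B + 1))) = c / 2 * (B / (B + 1)) by field_simp]
        have : B / (B + 1) ≤ 1 := by rw [div_le_one (by linarith)]; linarith
        nlinarith
      nlinarith [abs_nonneg (s - t)]
    exact ((abs_add_le _ _).trans (add_le_add h5 h4)).trans h6
  -- integrate the pointwise bound
  have hI : Integrable (fun x => Φ (θ s x) - Φ (θ t x)) := (hintΦ s hsS).sub (hintΦ t ht)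
  have hJ : Integrable (fun x => (s - t) * (deriv Φ (θ t x) * θ' x)) := hintD.const_mul _
  have hsub : (∫ x, Φ (θ s x)) - (∫ x, Φ (θ t x)) - (s - t) • ∫ x, deriv Φ (θ t x) * θ' x =
      ∫ x, (Φ (θ s x) - Φ (θ t x) - (s - t) * (deriv Φ (θ t x) * θ' x)) := by
    rw [smul_eq_mul, ← integral_sub (hintΦ s hsS) (hintΦ t ht), ← integral_const_mul,
      ← integral_sub hI hJ]
  rw [hsub, Real.norm_eq_abs, Real.norm_eq_abs]
  have h1 := norm_integral_le_of_norm_le_const (μ := (volume : Measure (UnitAddTorus d)))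
    (f := fun x => Φ (θ s x) - Φ (θ t x) - (s - t) * (deriv Φ (θ t x) * θ' x))
    (C := c * |s - t|) (ae_of_all _ fun x => by rw [Real.norm_eq_abs]; exact hpt x)
  simpa [Real.norm_eq_abs] using h1

end VorticityC1Weight

open VorticityC1Weight in
/-- **Weighted vorticity balance with a `C¹` weight** (Gibbon 2010, App. A, proof of Prop. 1,
opening identity `(1/2m) J̇ₘ = ∫ |ω|^{2(m−1)} ω·{νΔω + ω·∇u + curl f}`, here for a general weight
`Φ` of class `C¹` in place of `sᵐ`; Majda–Bertozzi 2002, (1.31)–(1.32) for the pointwise vorticity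
equation). Let `(u, p)` be a classical solution of `∂ₜu + (u·∇)u = νΔu − ∇p + f`, `div u = 0` on
`T^d × [a, b]` (`a < b`), and let `Φ` be `C¹` on an open set `U ⊆ ℝ` containing every value
`|ω(s, x)|²`, `s ∈ [a, b]`. Then `s ↦ ∫ Φ(|ω(s)|²)` has, at every `t ∈ [a, b]`, the one-sided
derivative

`2 ∫ Φ'(|ω|²) σ + ν ∫ Φ'(|ω|²) ∑ᵢⱼ Wᵢⱼ ΔWᵢⱼ + ∫ Φ'(|ω|²) ∑ᵢⱼ Wᵢⱼ(∂ᵢfⱼ − ∂ⱼfᵢ)`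

within `[a, b]` (`σ = torusStretchingDensity`; the transport term `∫ Φ'(|ω|²)(u·∇)|ω|² =
∫ div(Φ(|ω|²) u) = 0` by the `C¹` divergence theorem on the torus; the viscous term is left as
printed — for `C^∞` weights `TorusWeightedVorticityBalance` integrates it by parts). [cite: Gibbon2010, Appendix A (proof of Prop. 1), opening identity] -/
theorem _root_.Literature.Analysis.FunctionSpaces.Torus.IsClassicalNSSolutionOn.hasDerivWithinAt_integral_comp_torusVorticitySqAt_of_contDiffOn_one
    {a b ν : ℝ} {f u : ℝ → UnitAddTorus d → EuclideanSpace ℝ d} {p : ℝ → UnitAddTorus d → ℝ}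
    (h : Torus.IsClassicalNSSolutionOn (Icc a b) ν f u p) (hab : a < b) {Φ : ℝ → ℝ} {U : Set ℝ}
    (hUo : IsOpen U) (hΦ : ContDiffOn ℝ 1 Φ U)
    (hmaps : ∀ s ∈ Icc a b, ∀ x, torusVorticitySqAt (u s) x ∈ U) {t : ℝ} (ht : t ∈ Icc a b) :
    HasDerivWithinAt (fun s => ∫ x, Φ (torusVorticitySqAt (u s) x))
      (2 * (∫ x, deriv Φ (torusVorticitySqAt (u t) x) * torusStretchingDensity (u t) x) +
        ν * (∫ x, deriv Φ (torusVorticitySqAt (u t) x) * ∑ i, ∑ j,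
          torusVorticityTensor (u t) i j x * Torus.laplacian (torusVorticityTensor (u t) i j) x) +
        ∫ x, deriv Φ (torusVorticitySqAt (u t) x) * ∑ i, ∑ j, torusVorticityTensor (u t) i j x *
          (Torus.partialDeriv i (f t) x j - Torus.partialDeriv j (f t) x i))
      (Icc a b) t := by
  set S : Set ℝ := Icc a b with hSdef
  have hU : UniqueDiffOn ℝ S := uniqueDiffOn_Icc hab
  have hu : Torus.IsSmoothSpaceTimeOn S u := h.smooth_velocity
  have hut : Torus.IsSmooth (u t) := hu.isSmooth_slice ht
  have hdivt : Torus.IsDivFree (u t) := h.divFree t ht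
  have hQst := isSmoothSpaceTimeOn_Q hu hab
  have hQc : Continuous (torusVorticitySqAt (u t)) := (isSmooth_Q hut).continuous
  have hW : ∀ i j, Torus.IsSmooth (torusVorticityTensor (u t) i j) := fun i j => isSmooth_W hut i j
  have hΦ'c : ContinuousOn (deriv Φ) U := hΦ.continuousOn_deriv_of_isOpen hUo le_rfl
  have hG1c : Continuous (fun y => deriv Φ (torusVorticitySqAt (u t) y)) :=
    hΦ'c.comp_continuous hQc (hmaps t ht)
  -- the forcing slice is smooth (momentum equation)
  have hf : Torus.IsSmooth (f t) := by
    have hA : Torus.IsSmooth (Torus.timeDerivWithin S u t) := hu.isSmooth_timeDerivWithin hU ht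
    have hfun : f t = fun y => Torus.timeDerivWithin S u t y + Torus.convect (u t) (u t) y -
        ν • Torus.laplacian (u t) y + Torus.gradient (p t) y := by
      funext y
      have := h.momentum t ht y
      rw [this]
      abel
    rw [hfun]
    exact ((hA.add (hut.convect hut)).sub (hut.laplacian.smul ν)).add
      (h.smooth_pressure.isSmooth_slice ht).gradient
  -- smoothness of the three smooth factors
  have hσs : Torus.IsSmooth (torusStretchingDensity (u t)) := isSmooth_σ hut
  have hV1 : ∀ i j, Torus.IsSmooth (fun y => torusVorticityTensor (u t) i j y *
      Torus.laplacian (torusVorticityTensor (u t) i j) y) :=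
    fun i j => (hW i j).mul (hW i j).laplacian
  have hVs : Torus.IsSmooth (fun y => ∑ i, ∑ j, torusVorticityTensor (u t) i j y *
      Torus.laplacian (torusVorticityTensor (u t) i j) y) := isSmooth_sum₂ hV1
  have hF1 : ∀ i j, Torus.IsSmooth (fun y => torusVorticityTensor (u t) i j y *
      (Torus.partialDeriv i (f t) y j - Torus.partialDeriv j (f t) y i)) :=
    fun i j => (hW i j).mul (((hf.partialDeriv i).apply j).sub ((hf.partialDeriv j).apply i))
  have hFs : Torus.IsSmooth (fun y => ∑ i, ∑ j, torusVorticityTensor (u t) i j y *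
      (Torus.partialDeriv i (f t) y j - Torus.partialDeriv j (f t) y i)) := isSmooth_sum₂ hF1
  have hT1 : ∀ k i j, Torus.IsSmooth (fun y => torusVorticityTensor (u t) i j y *
      Torus.partialDeriv k (torusVorticityTensor (u t) i j) y) :=
    fun k i j => (hW i j).mul ((hW i j).partialDeriv k)
  have hT2 : ∀ k, Torus.IsSmooth (fun y => ∑ i, ∑ j, torusVorticityTensor (u t) i j y *
      Torus.partialDeriv k (torusVorticityTensor (u t) i j) y) := fun k => isSmooth_sum₂ (hT1 k)
  have hT3 : ∀ k, Torus.IsSmooth (fun y => u t y k * ∑ i, ∑ j, torusVorticityTensor (u t) i j y *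
      Torus.partialDeriv k (torusVorticityTensor (u t) i j) y) :=
    fun k => (hut.apply k).mul (hT2 k)
  have hTs : Torus.IsSmooth (fun y => ∑ k, u t y k * ∑ i, ∑ j, torusVorticityTensor (u t) i j y *
      Torus.partialDeriv k (torusVorticityTensor (u t) i j) y) := isSmooth_sum₁ hT3
  -- integrability of the four products
  have hIσ : Integrable (fun x => deriv Φ (torusVorticitySqAt (u t) x) *
      torusStretchingDensity (u t) x) := integrable_of_continuous (hG1c.mul hσs.continuous)
  have hIV : Integrable (fun x => deriv Φ (torusVorticitySqAt (u t) x) * ∑ i, ∑ j,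
      torusVorticityTensor (u t) i j x * Torus.laplacian (torusVorticityTensor (u t) i j) x) :=
    integrable_of_continuous (hG1c.mul hVs.continuous)
  have hIF : Integrable (fun x => deriv Φ (torusVorticitySqAt (u t) x) * ∑ i, ∑ j,
      torusVorticityTensor (u t) i j x *
        (Torus.partialDeriv i (f t) x j - Torus.partialDeriv j (f t) x i)) :=
    integrable_of_continuous (hG1c.mul hFs.continuous)
  have hIT : Integrable (fun x => deriv Φ (torusVorticitySqAt (u t) x) * ∑ k, u t x k * ∑ i, ∑ j,
      torusVorticityTensor (u t) i j x * Torus.partialDeriv k (torusVorticityTensor (u t) i j) x) :=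
    integrable_of_continuous (hG1c.mul hTs.continuous)
  -- Step 1: differentiate under the integral sign (C¹ chain rule)
  have hD := hasDerivWithinAt_integral_comp_C1 hab hQst hUo hΦ hmaps ht
  refine hD.congr_deriv ?_
  -- Step 2: insert the transport identity for `|ω|²` and split the integral
  have hpt : ∀ x, deriv Φ (torusVorticitySqAt (u t) x) *
      Torus.timeDerivWithin (Icc a b) (fun s y => torusVorticitySqAt (u s) y) t x =
      2 * (deriv Φ (torusVorticitySqAt (u t) x) * torusStretchingDensity (u t) x) +
        ν * (deriv Φ (torusVorticitySqAt (u t) x) * ∑ i, ∑ j,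
          torusVorticityTensor (u t) i j x * Torus.laplacian (torusVorticityTensor (u t) i j) x) +
        deriv Φ (torusVorticitySqAt (u t) x) * ∑ i, ∑ j, torusVorticityTensor (u t) i j x *
          (Torus.partialDeriv i (f t) x j - Torus.partialDeriv j (f t) x i) -
        deriv Φ (torusVorticitySqAt (u t) x) * ∑ k, u t x k * ∑ i, ∑ j,
          torusVorticityTensor (u t) i j x *
            Torus.partialDeriv k (torusVorticityTensor (u t) i j) x := by
    intro x
    rw [h.timeDerivWithin_torusVorticitySqAt hab ht x]
    ring
  simp_rw [hpt]
  have hI1 : Integrable (fun x => 2 * (deriv Φ (torusVorticitySqAt (u t) x) *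
      torusStretchingDensity (u t) x)) := hIσ.const_mul 2
  have hI2 : Integrable (fun x => ν * (deriv Φ (torusVorticitySqAt (u t) x) * ∑ i, ∑ j,
      torusVorticityTensor (u t) i j x * Torus.laplacian (torusVorticityTensor (u t) i j) x)) :=
    hIV.const_mul ν
  have hI12 : Integrable (fun x => 2 * (deriv Φ (torusVorticitySqAt (u t) x) *
      torusStretchingDensity (u t) x) + ν * (deriv Φ (torusVorticitySqAt (u t) x) * ∑ i, ∑ j,
      torusVorticityTensor (u t) i j x * Torus.laplacian (torusVorticityTensor (u t) i j) x)) :=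
    hI1.add hI2
  have hI123 : Integrable (fun x => 2 * (deriv Φ (torusVorticitySqAt (u t) x) *
      torusStretchingDensity (u t) x) + ν * (deriv Φ (torusVorticitySqAt (u t) x) * ∑ i, ∑ j,
      torusVorticityTensor (u t) i j x * Torus.laplacian (torusVorticityTensor (u t) i j) x) +
      deriv Φ (torusVorticitySqAt (u t) x) * ∑ i, ∑ j, torusVorticityTensor (u t) i j x *
        (Torus.partialDeriv i (f t) x j - Torus.partialDeriv j (f t) x i)) := hI12.add hIF
  rw [integral_sub hI123 hIT, integral_add hI12 hIF, integral_add hI1 hI2, integral_const_mul,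
    integral_const_mul, integral_deriv_comp_mul_convect_Q_eq_zero_C1 hut hdivt hUo hΦ (hmaps t ht),
    sub_zero]

open VorticityC1Weight in
/-- **Exact `Z_q` balance for every real `q ≥ 2`** (Gibbon 2010, §1: moments for real `m ≥ 1`;
App. A, proof of Prop. 1, opening identity with `q = 2m`:
`J̇ₘ = 2m ∫ |ω|^{2(m−1)} ω·{νΔω + ω·∇u + curl f}`). Along a classical solution on
`T^d × [a, b]` (`a < b`), for every real `q ≥ 2` and `t ∈ [a, b]`,
`s ↦ ∫ (torusVorticitySqAt (u s) x)^{q/2} = ∫|ω(s)|^q` has the one-sided derivative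

`q ∫ (|ω|²)^{q/2−1} σ + (q/2) (ν ∫ (|ω|²)^{q/2−1} ∑ᵢⱼ WᵢⱼΔWᵢⱼ + ∫ (|ω|²)^{q/2−1} ∑ᵢⱼ Wᵢⱼ(∂ᵢfⱼ − ∂ⱼfᵢ))`

within `[a, b]` (the weight `s ↦ s^{q/2}` is `C¹` on `ℝ` for `q/2 ≥ 1`,
`Real.contDiff_rpow_const_of_le`; in `d = 3`, `∑ᵢⱼWᵢⱼΔWᵢⱼ = 2ω·Δω`, `σ = ω·(ω·∇)u`,
`∑ᵢⱼWᵢⱼ(∂ᵢfⱼ − ∂ⱼfᵢ) = 2ω·curl f`). [cite: Gibbon2010, §1 (moments for real m ≥ 1) and Appendix A (proof of Prop. 1), opening identity] -/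
theorem _root_.Literature.Analysis.FunctionSpaces.Torus.IsClassicalNSSolutionOn.hasDerivWithinAt_integral_torusVorticitySqAt_rpow
    {a b ν : ℝ} {f u : ℝ → UnitAddTorus d → EuclideanSpace ℝ d} {p : ℝ → UnitAddTorus d → ℝ}
    (h : Torus.IsClassicalNSSolutionOn (Icc a b) ν f u p) (hab : a < b) {q : ℝ} (hq : 2 ≤ q)
    {t : ℝ} (ht : t ∈ Icc a b) :
    HasDerivWithinAt (fun s => ∫ x, torusVorticitySqAt (u s) x ^ (q / 2))
      (q * (∫ x, torusVorticitySqAt (u t) x ^ (q / 2 - 1) * torusStretchingDensity (u t) x) +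
        q / 2 * (ν * (∫ x, torusVorticitySqAt (u t) x ^ (q / 2 - 1) * ∑ i, ∑ j,
            torusVorticityTensor (u t) i j x * Torus.laplacian (torusVorticityTensor (u t) i j) x) +
          ∫ x, torusVorticitySqAt (u t) x ^ (q / 2 - 1) * ∑ i, ∑ j, torusVorticityTensor (u t) i j x *
            (Torus.partialDeriv i (f t) x j - Torus.partialDeriv j (f t) x i)))
      (Icc a b) t := by
  have hp1 : (1 : ℝ) ≤ q / 2 := by linarith
  have hΦ : ContDiffOn ℝ 1 (fun y : ℝ => y ^ (q / 2)) univ :=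
    (Real.contDiff_rpow_const_of_le (p := q / 2) (n := 1) (by exact_mod_cast hp1)).contDiffOn
  have hd : ∀ y : ℝ, deriv (fun y : ℝ => y ^ (q / 2)) y = q / 2 * y ^ (q / 2 - 1) := fun y =>
    (Real.hasDerivAt_rpow_const (p := q / 2) (Or.inr hp1)).deriv
  have hD := h.hasDerivWithinAt_integral_comp_torusVorticitySqAt_of_contDiffOn_one hab isOpen_univ hΦ
    (fun _ _ _ => mem_univ _) ht
  refine hD.congr_deriv ?_
  simp only [hd]
  have e1 : ∀ g : UnitAddTorus d → ℝ, (∫ x, q / 2 * torusVorticitySqAt (u t) x ^ (q / 2 - 1) * g x) =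
      q / 2 * ∫ x, torusVorticitySqAt (u t) x ^ (q / 2 - 1) * g x := by
    intro g
    rw [← integral_const_mul]
    exact integral_congr_ae (ae_of_all _ fun x => by ring)
  rw [e1, e1, e1]
  ring

open VorticityC1Weight in
/-- **Unforced case, real `q ≥ 2`**: along a classical solution of the unforced system (`f = 0`,
any `ν`) on `T^d × [a, b]`, `s ↦ ∫ (|ω(s)|²)^{q/2}` has the one-sided derivative
`q ∫ (|ω|²)^{q/2−1} σ + (q/2) ν ∫ (|ω|²)^{q/2−1} ∑ᵢⱼ WᵢⱼΔWᵢⱼ` within `[a, b]`; for EULER (`ν = 0`)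
this is exactly `q ∫ (|ω|²)^{q/2−1} σ` (`hasDerivWithinAt_integral_torusVorticitySqAt_rpow_euler`).
Gibbon 2010, App. A, opening identity with `f = 0`. [cite: Gibbon2010, Appendix A (proof of Prop. 1), opening identity] -/
theorem _root_.Literature.Analysis.FunctionSpaces.Torus.IsClassicalNSSolutionOn.hasDerivWithinAt_integral_torusVorticitySqAt_rpow_unforced
    {a b ν : ℝ} {u : ℝ → UnitAddTorus d → EuclideanSpace ℝ d} {p : ℝ → UnitAddTorus d → ℝ}
    (h : Torus.IsClassicalNSSolutionOn (Icc a b) ν 0 u p) (hab : a < b) {q : ℝ} (hq : 2 ≤ q)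
    {t : ℝ} (ht : t ∈ Icc a b) :
    HasDerivWithinAt (fun s => ∫ x, torusVorticitySqAt (u s) x ^ (q / 2))
      (q * (∫ x, torusVorticitySqAt (u t) x ^ (q / 2 - 1) * torusStretchingDensity (u t) x) +
        q / 2 * ν * ∫ x, torusVorticitySqAt (u t) x ^ (q / 2 - 1) * ∑ i, ∑ j,
          torusVorticityTensor (u t) i j x * Torus.laplacian (torusVorticityTensor (u t) i j) x)
      (Icc a b) t := by
  have hD := h.hasDerivWithinAt_integral_torusVorticitySqAt_rpow hab hq ht
  refine hD.congr_deriv ?_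
  have h0 : ∀ x, ∑ i, ∑ j, torusVorticityTensor (u t) i j x *
      (Torus.partialDeriv i ((0 : ℝ → UnitAddTorus d → EuclideanSpace ℝ d) t) x j -
        Torus.partialDeriv j ((0 : ℝ → UnitAddTorus d → EuclideanSpace ℝ d) t) x i) = 0 := by
    intro x
    have h0' : ∀ i, Torus.partialDeriv i (0 : UnitAddTorus d → EuclideanSpace ℝ d) x = 0 := by
      intro i
      simp [Torus.partialDeriv, Torus.lineDeriv]
    simp [h0']
  simp only [h0, mul_zero, integral_zero, add_zero]
  ring

/-- **Euler, unforced, real `q ≥ 2`: `d/dt Z_q = q ∫ (|ω|²)^{q/2−1} σ` exactly** along a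
classical solution of the incompressible Euler equations (`ν = 0`, `f = 0`) on `T^d × [a, b]`
(Gibbon 2010, App. A, opening identity with `ν = 0`, `f = 0`; `σ = ω·(ω·∇)u` in `d = 3`). This
is the exact derivative the static ⇔ dynamic reduction for `Z_q` uses at `t = 0` along the local
Euler solution issued from a given divergence-free field. [cite: Gibbon2010, Appendix A (proof of Prop. 1), opening identity] -/
theorem _root_.Literature.Analysis.FunctionSpaces.Torus.IsClassicalNSSolutionOn.hasDerivWithinAt_integral_torusVorticitySqAt_rpow_euler
    {a b : ℝ} {u : ℝ → UnitAddTorus d → EuclideanSpace ℝ d} {p : ℝ → UnitAddTorus d → ℝ}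
    (h : Torus.IsClassicalNSSolutionOn (Icc a b) 0 0 u p) (hab : a < b) {q : ℝ} (hq : 2 ≤ q)
    {t : ℝ} (ht : t ∈ Icc a b) :
    HasDerivWithinAt (fun s => ∫ x, torusVorticitySqAt (u s) x ^ (q / 2))
      (q * ∫ x, torusVorticitySqAt (u t) x ^ (q / 2 - 1) * torusStretchingDensity (u t) x)
      (Icc a b) t := by
  have hD := h.hasDerivWithinAt_integral_torusVorticitySqAt_rpow_unforced hab hq ht
  refine hD.congr_deriv ?_
  ring

end Literature.Analysis.FluidPDE
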